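import Summits.QuantumFields.YangMills.Theorems.BalabanUVNodesN15KingModelGraphReplacementEngine
import Literature.MathematicalPhysics.QuantumFieldTheory.King1986.SlicePropagatorStatementsAt

/-!
# BalabanUVNodes ∕ N15 — THE KING-MODEL RUNG (PART Η-b): PROPOSITION 3.6's REPLACEMENT STEP FOR GRAPHS WHOSE INTERNAL LINES CARRY KING's SLICES
# `G^η_{(j)}`, `∂^η_μG^η_{(j)}` — on the typer's `King1986.SlicePropagator.TwoSpacing` record, with PROPOSITION 3.7 (3.63) as the sizes and
# PROPOSITION 3.9 (3.73) as the two-spacing rates BY NAME (`Prop37PrintedAt`, `Prop39PrintedAt`): `|E^{(k+n)}(H(j)) − E^{(k)}(H(j))| ≤ L^{−γk}·Σ_ℓ 𝔼(H(j); ℓ lowered by γ) + …`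
# (Track A, DAG node N15 = NE2; FAN-OUT v1.1 §N15 s3 «KING-MODEL RUNG … NE2's analogue DECIDED in the model»)

HONEST FRAMING.  Count-neutral (cell `pub-ymgap`, seat `pub-ymgap-dag-n15-e` g25; `--supports stmt-QuantumFields-27366 --as helper` = K3⁸
`SpineGivenEndpointR13SepCoPHV`).  TEMPLATE LITERATURE: C. King, *The U(1) Higgs model. I. The continuum limit*, Commun. Math. Phys. **102** (1986) 649–677
[King1986], proof of Proposition 3.6, pp. 663–665: the internal lines of `E^{(k)}(H(j))` carry the slices of (2.17)∕(3.59) with the sizes of Proposition 3.7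
(3.63) and the two-spacing rates of Proposition 3.9 (3.73); the replacement step (part Η-a `…KingModelGraphReplacementEngine`, the generic engine) then
bounds the η-difference of the graph value.  MODEL LEVEL (abstract `TwoSpacing` data; part Η-c instantiates King's `A = 0` slices by name).  NOT Bałaban's
non-abelian `G(U)` of [B9]; NOT a node discharge; nothing continuum ∕ ℝ⁴ ∕ OS ∕ mass-gap ∕ Clay.  0 `sorry`; standard axioms.

THE PRINT.  p. 663 [PDF 15]: *«Every internal line in H carries a propagator G_k, G_k(□′) or one of their derivatives, which may be decomposed by writing
G_k = Σ_{j=0}^{k−1} G_{(j)}, see (2.17). … Denoting by H(j) the graph with specified integers j = {j_{l(p)}} on each internal line …»*; Prop. 3.7 (3.63):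
*«|G^η_{(j)}(x, y)|, |∂^η_μG^η_{(j)}(x, y)| ≤ C{(L^jη)^{2−d}, (L^jη)^{1−d}}·exp[−δ₀(L^jη)^{−1}|x − y|] … Furthermore, if we replace G^η_{(j)} by G^{η′}_{(j)}
throughout … the bounds are valid»*; p. 665 [PDF 17], Prop. 3.9 (3.73): *«|G^{η′}_{(j)}(x′, y′) − G^η_{(j)}(x, y)|, |∂^{η′}_μG^{η′}_{(j)}(x′, y′) − ∂^η_μG^η_{(j)}(x, y)|
≤ CL^{−γk}{(L^jη)^{2−d−γ}, (L^jη)^{1−d−γ}} exp[−δ₀(L^jη)^{−1}|x − y|]»*; and *«If we replace a propagator G^{η′}_{(j)}(x′, y′) by G^η_{(j)}(x, y), the error is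
the same graph with a difference of propagators on one line. Redoing the analysis, we see that the degrees of some subgraphs have been reduced by γ; for γ
small enough, the exponents D(H_i) − γ are still positive, and the bound proceeds as before. This replacement is made for every internal line …»*

WHAT THIS FILE PROVES (namespace `Summit.QuantumFields.YangMills.BalabanUVNodes.N15KingModelRung.Graph`; `T : TwoSpacing d` the typer's record — coarse
slices `T.lo.G j`, `T.lo.dG j μ` on `T.lo.S = T_η`, fine slices `T.hi.G j`, `T.hi.dG j μ` on `T.hi.S = T_{η′}`, King's pairing `T.pt`, slice lengths
`T.lo.slice j = L^jη`; a graph shape `H(j)`: vertices `V`, internal lines `Λ` with endpoints `src tgt : Λ → V`, slice indices `js : Λ → ℕ` (`j_ℓ + 1 ≤ k`) and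
kinds `κ : Λ → Option (Fin d)` (`none` = `G_(j)`, `some μ` = `∂_μG_(j)`), one-vertex factors `Υ` kept abstract (external lines, sources, dressings — part Η-c)).
* §1 `lineExp` (`2 − d` ∕ `1 − d`), `loLine`∕`hiLine` (the line kernels of `E^{(k)}(H(j))` ∕ `E^{(k+n)}(H(j))`), ★ `sizeProfile` = the RHS of (3.63), ★ `rateProfile`
  = the RHS of (3.73), `reducedProfile` = (3.73) without `L^{−γk}` (the size profile with THE EXPONENT LOWERED BY γ), `rateProfile_eq`,
  `rateProfile_eq_ratio_mul` + `lineRatio_eq` ((3.73)-profile `= L^{−γk}(L^jη)^{−γ}` × (3.63)-profile `= L^{−γj}` × it), nonnegativity;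
  `loLine_le_sizeProfile` (⇐ `Prop37PrintedAt`), `hiLine_sub_loLine_le_rateProfile` (⇐ `Prop39PrintedAt`).
* §2 `graphVal_update_mul'`, `graphValLS_line_update_mul` (a scalar on ONE replaced line comes out of the majorant graph value).
* §3 ★★★ **`graph_replacement_twoSpacing`**: under `Prop37PrintedAt α T.lo C δ₀` (coarse sizes), the fine slices' sizes IN COARSE CURRENCY (Prop. 3.7
  «Furthermore …» read through the pairing — an explicit hypothesis, discharged in part Η-c from the `(k+n)`-run's Prop. 3.7 and the pairing defect),
  `Prop39PrintedAt α T C δ₀ γ` (rates), uniform fibres `#pt⁻¹(x) = m` with `m·w′ = w`, and abstract one-vertex factors with sizes `p_υ` and rates `q_υ`: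
  `‖E_hi(H(j)) − E_lo(H(j))‖ ≤ Σ_ℓ 𝔼(H(j); ℓ ↦ (3.73)-profile) + Σ_υ 𝔼(H(j); υ ↦ q_υ)` («the same graph with a difference of propagators on one line», summed);
  ★★★ **`graph_replacement_twoSpacing_reduced`**: `= L^{−γk}·Σ_ℓ 𝔼(H(j); ℓ at the exponent lowered by γ) + Σ_υ …` — King's «the degrees of some subgraphs have
  been reduced by γ»; ★★★ **`graph_replacement_twoSpacing_ratio`**: the line sum COLLAPSES — `‖E_hi − E_lo‖ ≤ (Σ_ℓ L^{−γ j_ℓ} + Σ_υ ϑ_υ)·𝔼(H(j))` (the η-rate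
  of `H(j)` is `Σ_ℓ L^{−γ j_ℓ}` times its size; no gain on the finest slices — that is what the positive degrees are for); ★ `graph_size_twoSpacing` (the size half).

HONEST SCOPE.  (a) The replacement step of Prop. 3.6's proof with King's line data; the POWER COUNTING that sums `𝔼(H(j); ℓ lowered by γ)` over `j` into the
tree decay `C(L^kε)^{…}exp[−δ dist_t]` of (3.56) ((3.67)–(3.70), degrees, §3.5) is NOT claimed (part Μ has the letters).  (b) Internal lines = slices `G_(j)`,
`∂_μG_(j)` (the two members of (3.63)∕(3.73)); the contour kernels (3.64)∕(3.74) and the Hölder lines (3.65)∕(3.75) are not placed on lines here; one-vertex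
factors abstract.  (c) Abstract `TwoSpacing` data with finite site sorts; constants `C, δ₀, γ` free (the schema's); `L ≥ 1`.  Locators: [King1986] (2.17) p.653,
(3.59) p.663, Prop. 3.7 (3.63) p.663, Prop. 3.9 (3.73) p.665, pp.664–665 (replacement step).
-/

noncomputable section

namespace Summit.QuantumFields.YangMills.BalabanUVNodes.N15KingModelRung.Graph

open scoped BigOperators
open Finset
open Literature.MathematicalPhysics.QuantumFieldTheory.King1986.SlicePropagator (SliceKernels TwoSpacing Prop37PrintedAt Prop39PrintedAt)

variable {d : ℕ}

/-! ## §1 King's line data on the `TwoSpacing` record: kernels, the (3.63) size profile, the (3.73) rate profile -/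

section LineData

/-- the power of the slice length in (3.63)∕(3.73): `2 − d` for `G_(j)`, `1 − d` for `∂_μG_(j)`. [cite: King1986, Prop. 3.7 (3.63) p.663] -/
def lineExp (d : ℕ) : Option (Fin d) → ℝ
  | none => (2 : ℝ) - d
  | some _ => (1 : ℝ) - d

/-- reading. [cite: King1986, (3.63) p.663] -/
@[simp] theorem lineExp_none : lineExp d none = (2 : ℝ) - d := rfl

/-- reading. [cite: King1986, (3.63) p.663] -/
@[simp] theorem lineExp_some (μ : Fin d) : lineExp d (some μ) = (1 : ℝ) - d := rfl

/-- **the COARSE line kernel of `E^{(k)}(H(j))`**: the slice `G^η_{(j)}` or its derivative `∂^η_μG^η_{(j)}` on `T_η`. [cite: King1986, (2.17) p.653, (3.59) p.663] -/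
def loLine (T : TwoSpacing d) (j : ℕ) : Option (Fin d) → T.lo.S → T.lo.S → ℝ
  | none => T.lo.G j
  | some μ => T.lo.dG j μ

/-- **the FINE line kernel of `E^{(k+n)}(H(j))`**: `G^{η′}_{(j)}` or `∂^{η′}_μG^{η′}_{(j)}` on `T_{η′}` (the slice of (3.60) at the same length scale `L^jη`).
[cite: King1986, (3.60) p.663] -/
def hiLine (T : TwoSpacing d) (j : ℕ) : Option (Fin d) → T.hi.S → T.hi.S → ℝ
  | none => T.hi.G j
  | some μ => T.hi.dG j μ

/-- ★ **THE SIZE PROFILE = the right side of (3.63)**: `C·(L^jη)^{e}·exp[−δ₀(L^jη)^{−1}|x − y|]`, `e = 2 − d` or `1 − d`. [cite: King1986, Prop. 3.7 (3.63) p.663] -/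
def sizeProfile (T : TwoSpacing d) (C δ₀ : ℝ) (j : ℕ) (κ : Option (Fin d)) (x y : T.lo.S) : ℝ :=
  C * T.lo.slice j ^ lineExp d κ * Real.exp (-(δ₀ * (T.lo.slice j)⁻¹ * T.lo.dist x y))

/-- ★ **THE RATE PROFILE = the right side of (3.73)**: `C·L^{−γk}·(L^jη)^{e−γ}·exp[−δ₀(L^jη)^{−1}|x − y|]`. [cite: King1986, Prop. 3.9 (3.73) p.665] -/
def rateProfile (T : TwoSpacing d) (C δ₀ γ : ℝ) (j : ℕ) (κ : Option (Fin d)) (x y : T.lo.S) : ℝ :=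
  C * (T.lo.L : ℝ) ^ (-(γ * T.lo.k)) * T.lo.slice j ^ (lineExp d κ - γ) * Real.exp (-(δ₀ * (T.lo.slice j)⁻¹ * T.lo.dist x y))

/-- **THE REDUCED PROFILE** = (3.73) without the gain `L^{−γk}` = the size profile WITH THE EXPONENT LOWERED BY γ (p. 665: *«the degrees of some subgraphs have
been reduced by γ»*). [cite: King1986, p.665 (proof of Prop. 3.6), (3.73) p.665] -/
def reducedProfile (T : TwoSpacing d) (C δ₀ γ : ℝ) (j : ℕ) (κ : Option (Fin d)) (x y : T.lo.S) : ℝ :=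
  C * T.lo.slice j ^ (lineExp d κ - γ) * Real.exp (-(δ₀ * (T.lo.slice j)⁻¹ * T.lo.dist x y))

/-- `(3.73)-profile = L^{−γk} × reduced profile`. [cite: King1986, (3.73) p.665] -/
theorem rateProfile_eq (T : TwoSpacing d) (C δ₀ γ : ℝ) (j : ℕ) (κ : Option (Fin d)) (x y : T.lo.S) :
    rateProfile T C δ₀ γ j κ x y = (T.lo.L : ℝ) ^ (-(γ * T.lo.k)) * reducedProfile T C δ₀ γ j κ x y := by
  unfold rateProfile reducedProfile; ring

/-- **(3.73)-profile = `L^{−γk}·(L^jη)^{−γ}` × (3.63)-profile** — the rate IS proportional to the size, slice by slice. [cite: King1986, (3.63) p.663, (3.73) p.665] -/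
theorem rateProfile_eq_ratio_mul (T : TwoSpacing d) (hL : 0 < T.lo.L) (C δ₀ γ : ℝ) (j : ℕ) (κ : Option (Fin d)) (x y : T.lo.S) :
    rateProfile T C δ₀ γ j κ x y = ((T.lo.L : ℝ) ^ (-(γ * T.lo.k)) * T.lo.slice j ^ (-γ)) * sizeProfile T C δ₀ j κ x y := by
  unfold rateProfile sizeProfile
  rw [sub_eq_add_neg, Real.rpow_add (T.lo.slice_pos hL j)]
  ring

/-- **`L^{−γk}·(L^jη)^{−γ} = L^{−γj}`** (`η = L^{−k}`): the gain `L^{−γk}` of (3.73) against the loss `(L^jη)^{−γ}` of the lowered exponent nets the slice's own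
`L^{−γj}` — no gain on the finest slices, the full `L^{−γk}` on the unit-scale ones (which is why print needs the positive degrees `D(H_i) − γ > 0`).
[cite: King1986, p.665 («the degrees of some subgraphs have been reduced by γ»), (3.73) p.665] -/
theorem lineRatio_eq (T : TwoSpacing d) (hL : 0 < T.lo.L) (γ : ℝ) (j : ℕ) :
    (T.lo.L : ℝ) ^ (-(γ * T.lo.k)) * T.lo.slice j ^ (-γ) = (T.lo.L : ℝ) ^ (-(γ * j)) := by
  have hL' : (0 : ℝ) < T.lo.L := by exact_mod_cast hL
  unfold SliceKernels.slice SliceKernels.η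
  rw [Real.mul_rpow (pow_nonneg hL'.le _) (Literature.MathematicalPhysics.QuantumFieldTheory.King1986.ContinuumLimit.eps_pos hL _).le,
    Literature.MathematicalPhysics.QuantumFieldTheory.King1986.ContinuumLimit.eps_rpow hL, ← Real.rpow_natCast,
    ← Real.rpow_mul hL'.le, ← Real.rpow_add hL', ← Real.rpow_add hL']
  congr 1
  ring

/-- the size profile is nonnegative for `C ≥ 0`, `L ≥ 1`. [cite: King1986, (3.63) p.663] -/
theorem sizeProfile_nonneg (T : TwoSpacing d) {C : ℝ} (hC : 0 ≤ C) (hL : 0 < T.lo.L) (δ₀ : ℝ) (j : ℕ) (κ : Option (Fin d)) (x y : T.lo.S) :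
    0 ≤ sizeProfile T C δ₀ j κ x y :=
  mul_nonneg (mul_nonneg hC (Real.rpow_nonneg (T.lo.slice_pos hL j).le _)) (Real.exp_nonneg _)

/-- the reduced profile is nonnegative for `C ≥ 0`, `L ≥ 1`. [cite: King1986, (3.73) p.665] -/
theorem reducedProfile_nonneg (T : TwoSpacing d) {C : ℝ} (hC : 0 ≤ C) (hL : 0 < T.lo.L) (δ₀ γ : ℝ) (j : ℕ) (κ : Option (Fin d)) (x y : T.lo.S) :
    0 ≤ reducedProfile T C δ₀ γ j κ x y :=
  mul_nonneg (mul_nonneg hC (Real.rpow_nonneg (T.lo.slice_pos hL j).le _)) (Real.exp_nonneg _)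

/-- **PROPOSITION 3.7 (3.63) FEEDS THE COARSE LINE SIZES**: `‖loLine T j κ x y‖ ≤ sizeProfile T C δ₀ j κ x y` for every slice `j + 1 ≤ k` and both kinds.
[cite: King1986, Prop. 3.7 (3.63) p.663] -/
theorem loLine_le_sizeProfile (T : TwoSpacing d) {α C δ₀ : ℝ} (h37 : Prop37PrintedAt α T.lo C δ₀) {j : ℕ} (hj : j + 1 ≤ T.lo.k)
    (κ : Option (Fin d)) (x y : T.lo.S) : ‖loLine T j κ x y‖ ≤ sizeProfile T C δ₀ j κ x y := by
  rw [Real.norm_eq_abs]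
  rcases κ with _ | μ
  · exact ((h37 j hj).1 x y).1
  · exact ((h37 j hj).1 x y).2 μ

/-- **PROPOSITION 3.9 (3.73) FEEDS THE LINE RATES**: `‖hiLine T j κ x′ y′ − loLine T j κ (pt x′) (pt y′)‖ ≤ rateProfile T C δ₀ γ j κ (pt x′) (pt y′)`.
[cite: King1986, Prop. 3.9 (3.73) p.665] -/
theorem hiLine_sub_loLine_le_rateProfile (T : TwoSpacing d) {α C δ₀ γ : ℝ} (h39 : Prop39PrintedAt α T C δ₀ γ) {j : ℕ} (hj : j + 1 ≤ T.lo.k)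
    (κ : Option (Fin d)) (x' y' : T.hi.S) :
    ‖hiLine T j κ x' y' - loLine T j κ (T.pt x') (T.pt y')‖ ≤ rateProfile T C δ₀ γ j κ (T.pt x') (T.pt y') := by
  rw [Real.norm_eq_abs]
  rcases κ with _ | μ
  · have h := ((h39 j hj).1 x' y').1
    simpa only [hiLine, loLine, rateProfile, lineExp_none] using h
  · have h := ((h39 j hj).1 x' y').2 μ
    simpa only [hiLine, loLine, rateProfile, lineExp_some] using h

end LineData

/-! ## §2 A scalar on one replaced line comes out of the majorant graph value -/

section Scalar

variable {V S Φ : Type*} [Fintype V] [DecidableEq V] [Fintype S] [Fintype Φ] [DecidableEq Φ]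

/-- multilinearity in the replaced factor: `graphVal ω (M[φ ↦ c·N]) = c·graphVal ω (M[φ ↦ N])`. [folklore] -/
theorem graphVal_update_mul' (ω : ℝ) (M : Φ → (V → S) → ℝ) (φ : Φ) (c : ℝ) (N : (V → S) → ℝ) :
    graphVal ω (Function.update M φ (fun σ => c * N σ)) = c * graphVal ω (Function.update M φ N) := by
  unfold graphVal
  rw [mul_sum]
  refine sum_congr rfl fun σ _ => ?_
  have h : ∀ P : (V → S) → ℝ, ∏ ψ, Function.update M φ P ψ σ = P σ * ∏ ψ ∈ univ.erase φ, M ψ σ := fun P => by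
    rw [← Finset.prod_apply, prod_update_of_mem (mem_univ φ), Pi.mul_apply, Finset.prod_apply, sdiff_singleton_eq_erase]
  rw [h, h]; ring

variable {Λ Υ : Type*} [Fintype Λ] [DecidableEq Λ] [Fintype Υ] [DecidableEq Υ]

omit [Fintype Φ] [DecidableEq Φ] in
/-- **a scalar on ONE replaced line comes out**: `𝔼(P[ℓ ↦ c·Q]; p) = c·𝔼(P[ℓ ↦ Q]; p)`. [folklore] -/
theorem graphValLS_line_update_mul (ω : ℝ) (src tgt : Λ → V) (P : Λ → S → S → ℝ) (vtx : Υ → V) (p : Υ → S → ℝ) (ℓ : Λ) (c : ℝ)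
    (Q : S → S → ℝ) :
    graphValLS ω src tgt (Function.update P ℓ (fun x y => c * Q x y)) vtx p = c * graphValLS ω src tgt (Function.update P ℓ Q) vtx p := by
  rw [graphValLS_eq_graphVal (𝕜 := ℝ), graphValLS_eq_graphVal (𝕜 := ℝ), ← update_lsFactor_inl, ← update_lsFactor_inl]
  exact graphVal_update_mul' ω _ _ c (fun σ => Q (σ (src ℓ)) (σ (tgt ℓ)))

end Scalar

/-! ## §3 The replacement step for graphs with King's slices on the internal lines -/

section Replacement

variable (T : TwoSpacing d) [Fintype T.lo.S] [DecidableEq T.lo.S] [Fintype T.hi.S]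
variable {V Λ Υ : Type*} [Fintype V] [DecidableEq V] [Fintype Λ] [DecidableEq Λ] [Fintype Υ] [DecidableEq Υ]

/-- ★★★ **PROPOSITION 3.6's REPLACEMENT STEP WITH KING's LINE DATA.**  A graph shape `H(j)` (vertices `V`, internal lines `ℓ ∈ Λ` from `src ℓ` to `tgt ℓ`
carrying the slice `j_ℓ` of kind `κ_ℓ`, one-vertex factors `υ ∈ Υ` at `vtx υ`), its coarse value `E_lo = E^{(k)}(H(j))` (weight `w`, kernels `loLine`,
one-vertex factors `u`) and fine value `E_hi = E^{(k+n)}(H(j))` (weight `w′`, kernels `hiLine`, factors `u′`).  HYPOTHESES BY NAME: `Prop37PrintedAt α T.lo C δ₀`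
(Prop. 3.7: the coarse sizes (3.63)); the fine slices' sizes in coarse currency (Prop. 3.7 «Furthermore, if we replace G^η_{(j)} by G^{η′}_{(j)} throughout …
the bounds are valid», read through the pairing — `hhi`); `Prop39PrintedAt α T C δ₀ γ` (Prop. 3.9: the rates (3.73)); uniform fibres of the pairing
(`#pt⁻¹(x) = m`, `m·w′ = w`); one-vertex factors with sizes `p_υ` and rates `q_υ`.  CONCLUSION:
`‖E_hi − E_lo‖ ≤ Σ_ℓ 𝔼(H(j); ℓ ↦ (3.73)-profile) + Σ_υ 𝔼(H(j); υ ↦ q_υ)` — the majorant graph of the (3.63)-profiles with ONE line's profile replaced by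
the (3.73)-profile, summed over the lines («the error is the same graph with a difference of propagators on one line … This replacement is made for every
internal line»), plus the one-vertex replacements. [cite: King1986, pp.664–665 (proof of Prop. 3.6), Prop. 3.7 (3.63) p.663, Prop. 3.9 (3.73) p.665] -/
theorem graph_replacement_twoSpacing {α C δ₀ γ : ℝ} (h37 : Prop37PrintedAt α T.lo C δ₀)
    (hhi : ∀ j : ℕ, j + 1 ≤ T.lo.k → ∀ (κ : Option (Fin d)) (x' y' : T.hi.S),
      ‖hiLine T j κ x' y'‖ ≤ sizeProfile T C δ₀ j κ (T.pt x') (T.pt y'))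
    (h39 : Prop39PrintedAt α T C δ₀ γ)
    {m : ℕ} (hfib : ∀ x : T.lo.S, (univ.filter fun x' : T.hi.S => T.pt x' = x).card = m) {w w' : ℝ} (hw : (m : ℝ) * w' = w)
    (src tgt : Λ → V) (js : Λ → ℕ) (hjs : ∀ ℓ, js ℓ + 1 ≤ T.lo.k) (κ : Λ → Option (Fin d)) (vtx : Υ → V)
    (u : Υ → T.lo.S → ℝ) (u' : Υ → T.hi.S → ℝ) (p q : Υ → T.lo.S → ℝ)
    (hp : ∀ υ x, ‖u υ x‖ ≤ p υ x) (hp' : ∀ υ x', ‖u' υ x'‖ ≤ p υ (T.pt x')) (hq : ∀ υ x', ‖u' υ x' - u υ (T.pt x')‖ ≤ q υ (T.pt x')) :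
    ‖graphValLS w' src tgt (fun ℓ => hiLine T (js ℓ) (κ ℓ)) vtx u' - graphValLS w src tgt (fun ℓ => loLine T (js ℓ) (κ ℓ)) vtx u‖
      ≤ ∑ ℓ, graphValLS ‖w‖ src tgt (Function.update (fun ℓ => sizeProfile T C δ₀ (js ℓ) (κ ℓ)) ℓ (rateProfile T C δ₀ γ (js ℓ) (κ ℓ))) vtx p
        + ∑ υ, graphValLS ‖w‖ src tgt (fun ℓ => sizeProfile T C δ₀ (js ℓ) (κ ℓ)) vtx (Function.update p υ (q υ)) :=
  norm_graphValLS_sub_le (𝕜 := ℝ) T.pt hfib (by exact_mod_cast hw) src tgt vtx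
    (fun ℓ => loLine T (js ℓ) (κ ℓ)) (fun ℓ => hiLine T (js ℓ) (κ ℓ))
    (fun ℓ => sizeProfile T C δ₀ (js ℓ) (κ ℓ)) (fun ℓ => rateProfile T C δ₀ γ (js ℓ) (κ ℓ))
    (fun ℓ x y => loLine_le_sizeProfile T h37 (hjs ℓ) (κ ℓ) x y) (fun ℓ x' y' => hhi (js ℓ) (hjs ℓ) (κ ℓ) x' y')
    (fun ℓ x' y' => hiLine_sub_loLine_le_rateProfile T h39 (hjs ℓ) (κ ℓ) x' y') u u' p q hp hp' hq

/-- ★★★ **… = `L^{−γk}` × «THE SAME GRAPH WITH THE DEGREE OF ONE LINE LOWERED BY γ», SUMMED OVER THE LINES**: the line sum of the previous theorem equals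
`L^{−γk}·Σ_ℓ 𝔼(H(j); ℓ ↦ reduced profile)`, the reduced profile being the (3.63)-profile with the exponent `e` replaced by `e − γ` — King p. 665 *«Redoing the
analysis, we see that the degrees of some subgraphs have been reduced by γ; for γ small enough, the exponents D(H_i) − γ are still positive, and the bound
proceeds as before»*.  (The power counting that then sums over `j` is part Μ's letters + degrees, not here.)
[cite: King1986, p.665 (proof of Prop. 3.6), Prop. 3.9 (3.73) p.665] -/
theorem graph_replacement_twoSpacing_reduced {α C δ₀ γ : ℝ} (h37 : Prop37PrintedAt α T.lo C δ₀)
    (hhi : ∀ j : ℕ, j + 1 ≤ T.lo.k → ∀ (κ : Option (Fin d)) (x' y' : T.hi.S),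
      ‖hiLine T j κ x' y'‖ ≤ sizeProfile T C δ₀ j κ (T.pt x') (T.pt y'))
    (h39 : Prop39PrintedAt α T C δ₀ γ)
    {m : ℕ} (hfib : ∀ x : T.lo.S, (univ.filter fun x' : T.hi.S => T.pt x' = x).card = m) {w w' : ℝ} (hw : (m : ℝ) * w' = w)
    (src tgt : Λ → V) (js : Λ → ℕ) (hjs : ∀ ℓ, js ℓ + 1 ≤ T.lo.k) (κ : Λ → Option (Fin d)) (vtx : Υ → V)
    (u : Υ → T.lo.S → ℝ) (u' : Υ → T.hi.S → ℝ) (p q : Υ → T.lo.S → ℝ)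
    (hp : ∀ υ x, ‖u υ x‖ ≤ p υ x) (hp' : ∀ υ x', ‖u' υ x'‖ ≤ p υ (T.pt x')) (hq : ∀ υ x', ‖u' υ x' - u υ (T.pt x')‖ ≤ q υ (T.pt x')) :
    ‖graphValLS w' src tgt (fun ℓ => hiLine T (js ℓ) (κ ℓ)) vtx u' - graphValLS w src tgt (fun ℓ => loLine T (js ℓ) (κ ℓ)) vtx u‖
      ≤ (T.lo.L : ℝ) ^ (-(γ * T.lo.k))
          * ∑ ℓ, graphValLS ‖w‖ src tgt (Function.update (fun ℓ => sizeProfile T C δ₀ (js ℓ) (κ ℓ)) ℓ (reducedProfile T C δ₀ γ (js ℓ) (κ ℓ))) vtx p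
        + ∑ υ, graphValLS ‖w‖ src tgt (fun ℓ => sizeProfile T C δ₀ (js ℓ) (κ ℓ)) vtx (Function.update p υ (q υ)) := by
  refine (graph_replacement_twoSpacing T h37 hhi h39 hfib hw src tgt js hjs κ vtx u u' p q hp hp' hq).trans (le_of_eq ?_)
  congr 1
  rw [mul_sum]
  refine sum_congr rfl fun ℓ _ => ?_
  have h : rateProfile T C δ₀ γ (js ℓ) (κ ℓ) = fun x y => (T.lo.L : ℝ) ^ (-(γ * T.lo.k)) * reducedProfile T C δ₀ γ (js ℓ) (κ ℓ) x y :=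
    funext fun x => funext fun y => rateProfile_eq T C δ₀ γ (js ℓ) (κ ℓ) x y
  rw [h, graphValLS_line_update_mul]

/-- ★★★ **THE η-RATE OF `H(j)` IS `(Σ_ℓ L^{−γ j_ℓ} + Σ_υ ϑ_υ)` TIMES ITS SIZE**: since the (3.73)-profile is `L^{−γk}(L^{j_ℓ}η)^{−γ} = L^{−γ j_ℓ}` times
the (3.63)-profile, the line sum COLLAPSES onto the majorant graph itself; with one-vertex rates proportional to their sizes (`q_υ = ϑ_υ·p_υ`: the sources,
the dressings (3.72), the external lines (3.71)), `‖E_hi(H(j)) − E_lo(H(j))‖ ≤ (Σ_ℓ L^{−γ j_ℓ} + Σ_υ ϑ_υ)·𝔼(H(j))`.  HONEST: a line at the coarsest slices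
(`j_ℓ ≈ k`) contributes `≈ L^{−γk}`, a line at the finest slice (`j_ℓ = 0`) contributes `O(1)` — the smallness for small `j_ℓ` is in the SIZE `𝔼(H(j))`
(positive degrees), i.e. in the power counting that is not typed here. [cite: King1986, p.665 (proof of Prop. 3.6), (3.63) p.663, (3.73) p.665] -/
theorem graph_replacement_twoSpacing_ratio (hL : 0 < T.lo.L) {α C δ₀ γ : ℝ} (h37 : Prop37PrintedAt α T.lo C δ₀)
    (hhi : ∀ j : ℕ, j + 1 ≤ T.lo.k → ∀ (κ : Option (Fin d)) (x' y' : T.hi.S),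
      ‖hiLine T j κ x' y'‖ ≤ sizeProfile T C δ₀ j κ (T.pt x') (T.pt y'))
    (h39 : Prop39PrintedAt α T C δ₀ γ)
    {m : ℕ} (hfib : ∀ x : T.lo.S, (univ.filter fun x' : T.hi.S => T.pt x' = x).card = m) {w w' : ℝ} (hw : (m : ℝ) * w' = w)
    (src tgt : Λ → V) (js : Λ → ℕ) (hjs : ∀ ℓ, js ℓ + 1 ≤ T.lo.k) (κ : Λ → Option (Fin d)) (vtx : Υ → V)
    (u : Υ → T.lo.S → ℝ) (u' : Υ → T.hi.S → ℝ) (p : Υ → T.lo.S → ℝ) (ϑ : Υ → ℝ)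
    (hp : ∀ υ x, ‖u υ x‖ ≤ p υ x) (hp' : ∀ υ x', ‖u' υ x'‖ ≤ p υ (T.pt x'))
    (hq : ∀ υ x', ‖u' υ x' - u υ (T.pt x')‖ ≤ ϑ υ * p υ (T.pt x')) :
    ‖graphValLS w' src tgt (fun ℓ => hiLine T (js ℓ) (κ ℓ)) vtx u' - graphValLS w src tgt (fun ℓ => loLine T (js ℓ) (κ ℓ)) vtx u‖
      ≤ (∑ ℓ, (T.lo.L : ℝ) ^ (-(γ * js ℓ)) + ∑ υ, ϑ υ) * graphValLS ‖w‖ src tgt (fun ℓ => sizeProfile T C δ₀ (js ℓ) (κ ℓ)) vtx p := by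
  have h := norm_graphValLS_sub_le_of_ratio (𝕜 := ℝ) T.pt hfib (by exact_mod_cast hw) src tgt vtx
    (fun ℓ => loLine T (js ℓ) (κ ℓ)) (fun ℓ => hiLine T (js ℓ) (κ ℓ)) (fun ℓ => sizeProfile T C δ₀ (js ℓ) (κ ℓ))
    (fun ℓ => (T.lo.L : ℝ) ^ (-(γ * T.lo.k)) * T.lo.slice (js ℓ) ^ (-γ))
    (fun ℓ x y => loLine_le_sizeProfile T h37 (hjs ℓ) (κ ℓ) x y) (fun ℓ x' y' => hhi (js ℓ) (hjs ℓ) (κ ℓ) x' y')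
    (fun ℓ x' y' => by
      rw [← rateProfile_eq_ratio_mul T hL]
      exact hiLine_sub_loLine_le_rateProfile T h39 (hjs ℓ) (κ ℓ) x' y') u u' p ϑ hp hp' hq
  refine h.trans (le_of_eq ?_)
  congr 2
  exact sum_congr rfl fun ℓ _ => lineRatio_eq T hL γ (js ℓ)

omit [DecidableEq Λ] [DecidableEq Υ] in
/-- ★ **THE SIZE HALF**: both graph values are bounded by the majorant graph `𝔼(H(j))` of the (3.63)-profiles (the fine one in coarse currency through the
re-pairing) — p. 664 *«We get an upper bound for this expression by replacing every propagator by the bounds given in Proposition 3.7»*.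
[cite: King1986, p.664 (proof of Prop. 3.6), Prop. 3.7 (3.63) p.663] -/
theorem graph_size_twoSpacing {α C δ₀ : ℝ} (h37 : Prop37PrintedAt α T.lo C δ₀)
    (hhi : ∀ j : ℕ, j + 1 ≤ T.lo.k → ∀ (κ : Option (Fin d)) (x' y' : T.hi.S),
      ‖hiLine T j κ x' y'‖ ≤ sizeProfile T C δ₀ j κ (T.pt x') (T.pt y'))
    {m : ℕ} (hfib : ∀ x : T.lo.S, (univ.filter fun x' : T.hi.S => T.pt x' = x).card = m) {w w' : ℝ} (hw : (m : ℝ) * w' = w)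
    (src tgt : Λ → V) (js : Λ → ℕ) (hjs : ∀ ℓ, js ℓ + 1 ≤ T.lo.k) (κ : Λ → Option (Fin d)) (vtx : Υ → V)
    (u : Υ → T.lo.S → ℝ) (u' : Υ → T.hi.S → ℝ) (p : Υ → T.lo.S → ℝ)
    (hp : ∀ υ x, ‖u υ x‖ ≤ p υ x) (hp' : ∀ υ x', ‖u' υ x'‖ ≤ p υ (T.pt x')) :
    ‖graphValLS w src tgt (fun ℓ => loLine T (js ℓ) (κ ℓ)) vtx u‖ ≤ graphValLS ‖w‖ src tgt (fun ℓ => sizeProfile T C δ₀ (js ℓ) (κ ℓ)) vtx p ∧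
    ‖graphValLS w' src tgt (fun ℓ => hiLine T (js ℓ) (κ ℓ)) vtx u'‖ ≤ graphValLS ‖w‖ src tgt (fun ℓ => sizeProfile T C δ₀ (js ℓ) (κ ℓ)) vtx p := by
  have hM : ∀ φ σ, ‖lsFactor src tgt (fun ℓ => loLine T (js ℓ) (κ ℓ)) vtx u φ σ‖
      ≤ lsFactor src tgt (fun ℓ => sizeProfile T C δ₀ (js ℓ) (κ ℓ)) vtx p φ σ := by
    rintro (ℓ | υ) σ
    · exact loLine_le_sizeProfile T h37 (hjs ℓ) (κ ℓ) _ _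
    · exact hp υ _
  have hM' : ∀ φ σ', ‖lsFactor src tgt (fun ℓ => hiLine T (js ℓ) (κ ℓ)) vtx u' φ σ'‖
      ≤ lsFactor src tgt (fun ℓ => sizeProfile T C δ₀ (js ℓ) (κ ℓ)) vtx p φ (T.pt ∘ σ') := by
    rintro (ℓ | υ) σ'
    · exact hhi (js ℓ) (hjs ℓ) (κ ℓ) _ _
    · exact hp' υ _
  refine ⟨?_, ?_⟩
  · rw [graphValLS_eq_graphVal (𝕜 := ℝ), graphValLS_eq_graphVal (𝕜 := ℝ)]
    exact norm_graphVal_le (𝕜 := ℝ) w _ _ hM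
  · rw [graphValLS_eq_graphVal (𝕜 := ℝ), graphValLS_eq_graphVal (𝕜 := ℝ)]
    exact norm_graphVal_le_repaired (𝕜 := ℝ) T.pt hfib (by exact_mod_cast hw) _ _ hM'

end Replacement

end Summit.QuantumFields.YangMills.BalabanUVNodes.N15KingModelRung.Graph

end
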